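import Literature.RepresentationTheory.MoeglinVignerasWaldspurger1987.RankOneReflectionAsymmetry
import Literature.RepresentationTheory.TwistedCoinvariantsTypePeriodicity
import HarnessLib

/-!
# The `(U(1), U(1))` theta dichotomy, character route — torus lemmas: `U(J₁)(F_v)` is infinite, `u² = 1 ⇒ u = ±1`,
# coordinates of a multiple line, and the explicit trace formula on `𝒮^L`

[MoeglinVignerasWaldspurger1987] C. Mœglin, M.-F. Vignéras, J.-L. Waldspurger, LNM 1291, Chap. 3 §IV (theta
dichotomy for unitary groups over a `p`-adic field), rank `1 × 1` case, via A. Weil, Acta Math. 111 (1964):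
for the torus `T = U(J₁)(F_v) = E_v¹` at a non-split place `v` and two trace-zero `δ₁`, `δ₂ = α δ₁` with
`(α, d₁)_v = -1` (`δ₁² = d₁`; the skew-hermitian lines `δ₁ J₁`, `δ₂ J₁` lie in different classes), the oscillator
representations `ωᵢ = ω_{sᵢ}` of `T` (sections `sᵢ` over `ι_{δᵢ}`) have finite-level characters related by
`tr ω₂ = -θ · tr ω₁` off `{±1}` (next file, `rankOne_theta_character_ratio`).  This file holds the torus lemmas it
needs: §1 **`infinite_localPi_rankOne`** (the Cayley points `z(x₀ⁿ y)` of ★ `exists_cayley_unit` are pairwise distinct)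
and **`rankOne_eq_one_or_eq_negOne_of_mul_self_eq_one`** (`E_v` is a field at a non-split place); §2
**`quadraticCoordinates_of_mul`** (coordinates w.r.t. `δ₂ = αδ` are `(a, b/α)`) and **`rankOne_trace_fixedPoints_eq`**
(★ `rankOne_torusTrace_eq_explicit` specialised to `W = 𝒮^L`, finite-dimensional by multiplicity one ★
`finiteDimensional_weightSpace_rankOne`).  THEOREMS ONLY (cell `hodgecm-mathlib`, SOCKETS-H413 §3 S6 «G2a»);
count-neutral; HC_CM is proved only modulo the 7 printed citations until rung 0 closes.

## References
* [MoeglinVignerasWaldspurger1987] LNM 1291 (1987), Chap. 2 II.1 (A), II.8; Chap. 3 §IV.4.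
* [Weil1964] A. Weil, Acta Math. 111 (1964) 143–211, Chap. I n° 14, Chap. IV n° 42–44.
* [PlatonovRapinchuk1994] V. Platonov, A. Rapinchuk, *Algebraic groups and number theory*, §6.2.
-/

set_option autoImplicit false

noncomputable section

open NumberField IsDedekindDomain Matrix MeasureTheory
open scoped Matrix MatrixGroups NNReal Topology
open Literature.RepresentationTheory Literature.RepresentationTheory.HeisenbergGroup
open Literature.RepresentationTheory.TwistedCoinv
open Literature.NumberTheory.GelbartRogawski1991.UnitaryDualPair.LocalSplitting
open Literature.NumberTheory.Automorphic Literature.NumberTheory.Automorphic.UnitaryGroup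
open Literature.NumberTheory.Automorphic.Liu2021
open Literature.NumberTheory.GaloisRepresentations.IsNonarchimedeanLocalField
open Literature.NumberTheory.Weil1964 Literature.NumberTheory.QuadraticForms

namespace Literature.RepresentationTheory.MoeglinVignerasWaldspurger1987

/-! ## §1 `U(J₁)(F_v)` at a non-split place: `u² = 1 ⇒ u = ±1`, and the torus is infinite -/

section Torus

variable (F : Type) [Field F] [NumberField F] (E : Type) [Field E] [NumberField E] [Algebra F E]
  [Algebra.IsQuadraticExtension F E] (c : E ≃ₐ[F] E) {δ : E} (hcδ : c δ = -δ) (hδ : δ ≠ 0) {d : F}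
  (hd : δ * δ = algebraMap F E d) (J₁ : Matrix (Fin 1) (Fin 1) E) (v : HeightOneSpectrum (𝓞 F))
  (hE : IsField (UnitaryGroup.LocalRing E v))

omit [Algebra.IsQuadraticExtension F E] in
include hE in
/-- **`u² = 1 ⇒ u ∈ {1, -1}`** in `U(J₁)(F_v)` at a non-split place (`E_v` is a field).
[cite: PlatonovRapinchuk1994, §6.2] -/
theorem rankOne_eq_one_or_eq_negOne_of_mul_self_eq_one (u : localPi E c 1 J₁ v) (hu : u * u = 1) :
    u = 1 ∨ u = localUnitScalar E c J₁ v (-1) (negOne_mul_conjLocal_negOne E c v) := by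
  letI := hE.toField
  set ζ : LocalRing E v := fun w : PlacesOver E v => ((u : LocalGLPi E 1 v) w).val 0 0 with hζ
  have hζζ : ζ * ζ = 1 := by
    have h := rankOne_scalar_mul E c J₁ v u u
    rw [hu] at h
    rw [hζ, ← h]
    funext w; exact rankOne_entry_one E c J₁ v w
  rcases mul_self_eq_one_iff.1 hζζ with h1 | h1
  · refine Or.inl (rankOne_eq_of_forall_entry_eq E c J₁ v fun w => ?_)
    rw [rankOne_entry_one]
    exact congrFun h1 w
  · refine Or.inr (rankOne_eq_of_forall_entry_eq E c J₁ v fun w => ?_)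
    rw [coe_localUnitScalar_apply, Units.val_neg, Units.val_one]
    exact congrFun h1 w

include hcδ hδ hd in
/-- **`U(J₁)(F_v)` is infinite**: the Cayley points `z(x₀ⁿ y)` (`‖x₀‖ < 1`, `‖y² d‖ < 1`) are pairwise distinct, since
`b = 2x/(1 - x²d)` determines `x` on the ball `‖x²d‖ < 1`. [cite: PlatonovRapinchuk1994, §6.2] -/
theorem infinite_localPi_rankOne : Infinite (localPi E c 1 J₁ v) := by
  haveI : CharZero (v.adicCompletion F) := charZero_of_injective_algebraMap (algebraMap F _).injective
  have htwo : (2 : v.adicCompletion F) ≠ 0 := two_ne_zero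
  have hq := isQuadraticCoordinates_local E v c hcδ hδ hd
  -- a small `y ≠ 0` with `‖y² d‖ < 1` and `x₀ ≠ 0` with `‖x₀‖ < 1`
  obtain ⟨x₀, hx₀0, hx₀⟩ := exists_normAbs_eq_inv_zpow_of_int (F := v.adicCompletion F) 1
  rw [zpow_one] at hx₀
  have hq1 : (residueFieldCard (v.adicCompletion F) : ℝ≥0)⁻¹ < 1 :=
    inv_lt_one_of_one_lt₀ (by exact_mod_cast one_lt_residueFieldCard (v.adicCompletion F))
  obtain ⟨y, hy0, hyd⟩ : ∃ y : v.adicCompletion F, y ≠ 0 ∧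
      normAbs (v.adicCompletion F) (y ^ 2 * (d : v.adicCompletion F)) < 1 := by
    by_cases hd0 : (d : v.adicCompletion F) = 0
    · exact ⟨1, one_ne_zero, by rw [hd0, mul_zero, map_zero]; exact one_pos⟩
    by_cases hdle : normAbs (v.adicCompletion F) (d : v.adicCompletion F) ≤ 1
    · refine ⟨x₀, hx₀0, ?_⟩
      rw [map_mul, map_pow, hx₀]
      calc (residueFieldCard (v.adicCompletion F) : ℝ≥0)⁻¹ ^ 2 * normAbs (v.adicCompletion F) (d : v.adicCompletion F)
          ≤ (residueFieldCard (v.adicCompletion F) : ℝ≥0)⁻¹ ^ 2 * 1 := by gcongr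
        _ < 1 := by rw [mul_one]; exact pow_lt_one₀ bot_le hq1 two_ne_zero
    · have hdlt := not_le.1 hdle
      refine ⟨x₀ * (d : v.adicCompletion F)⁻¹, mul_ne_zero hx₀0 (inv_ne_zero hd0), ?_⟩
      have e : (x₀ * (d : v.adicCompletion F)⁻¹) ^ 2 * (d : v.adicCompletion F) = x₀ ^ 2 * (d : v.adicCompletion F)⁻¹ := by
        field_simp
      rw [e, map_mul, map_pow, map_inv₀, hx₀]
      calc (residueFieldCard (v.adicCompletion F) : ℝ≥0)⁻¹ ^ 2 * (normAbs (v.adicCompletion F) (d : v.adicCompletion F))⁻¹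
          ≤ (residueFieldCard (v.adicCompletion F) : ℝ≥0)⁻¹ ^ 2 * 1 := by
            gcongr; exact inv_le_one_of_one_le₀ hdlt.le
        _ < 1 := by rw [mul_one]; exact pow_lt_one₀ bot_le hq1 two_ne_zero
  -- the family `xₙ = x₀ⁿ y`
  set x : ℕ → v.adicCompletion F := fun n => x₀ ^ n * y with hx
  have hxn0 : ∀ n, x n ≠ 0 := fun n => mul_ne_zero (pow_ne_zero n hx₀0) hy0
  have hxnd : ∀ n, normAbs (v.adicCompletion F) (x n ^ 2 * (d : v.adicCompletion F)) < 1 := by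
    intro n
    have e : x n ^ 2 * (d : v.adicCompletion F) = (x₀ ^ n) ^ 2 * (y ^ 2 * (d : v.adicCompletion F)) := by rw [hx]; ring
    rw [e, map_mul, map_pow, map_pow, hx₀]
    calc ((residueFieldCard (v.adicCompletion F) : ℝ≥0)⁻¹ ^ n) ^ 2 * normAbs (v.adicCompletion F) (y ^ 2 * (d : v.adicCompletion F))
        ≤ 1 * normAbs (v.adicCompletion F) (y ^ 2 * (d : v.adicCompletion F)) := by
          gcongr; exact pow_le_one₀ bot_le (pow_le_one₀ bot_le hq1.le)
      _ < 1 := by rw [one_mul]; exact hyd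
  have hx1 : ∀ n, 1 - x n ^ 2 * (d : v.adicCompletion F) ≠ 0 := by
    intro n h0
    have h1 := normAbs_one_sub_eq_one (hxnd n)
    rw [h0, map_zero] at h1
    exact zero_ne_one h1
  -- the Cayley points and injectivity
  have hunit := fun n => exists_cayley_unit E c hcδ hδ hd v (x n) (hx1 n)
  choose u hu hun using hunit
  refine Infinite.of_injective (fun n => localUnitScalar E c J₁ v (u n) (hun n)) fun n n' hnn' => ?_
  have hsc : (u n : LocalRing E v) = (u n' : LocalRing E v) := by
    funext w
    have h := congrArg (fun g : localPi E c 1 J₁ v =>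
      (((g : LocalGLPi E 1 v) w : GL (Fin 1) (w.1.adicCompletion E)) : Matrix (Fin 1) (Fin 1) (w.1.adicCompletion E)) 0 0) hnn'
    simpa only [coe_localUnitScalar_apply] using h
  have him := congrArg (QuadraticCoordinates.im (quadraticLocalEquiv E v c hcδ hδ).toLinearEquiv.toAddEquiv) hsc
  rw [hu n, hu n', (cayley_re_im E c hcδ hδ hd v (x n)).2, (cayley_re_im E c hcδ hδ hd v (x n')).2] at him
  -- `2xₙ/(1 - xₙ²d) = 2xₙ'/(1 - xₙ'²d)` ⇒ `(xₙ - xₙ')(1 + xₙ xₙ' d) = 0`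
  have hprod : (x n - x n') * (1 + x n * x n' * (d : v.adicCompletion F)) = 0 := by
    have h1 := hx1 n
    have h2 := hx1 n'
    have h := congrArg (fun t => t * ((1 - x n ^ 2 * (d : v.adicCompletion F)) * (1 - x n' ^ 2 * (d : v.adicCompletion F)))) him
    rw [show (1 - x n ^ 2 * (d : v.adicCompletion F))⁻¹ * (2 * x n) *
          ((1 - x n ^ 2 * (d : v.adicCompletion F)) * (1 - x n' ^ 2 * (d : v.adicCompletion F))) =
          2 * x n * (1 - x n' ^ 2 * (d : v.adicCompletion F)) *
            ((1 - x n ^ 2 * (d : v.adicCompletion F))⁻¹ * (1 - x n ^ 2 * (d : v.adicCompletion F))) by ring,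
      inv_mul_cancel₀ h1, mul_one,
      show (1 - x n' ^ 2 * (d : v.adicCompletion F))⁻¹ * (2 * x n') *
          ((1 - x n ^ 2 * (d : v.adicCompletion F)) * (1 - x n' ^ 2 * (d : v.adicCompletion F))) =
          2 * x n' * (1 - x n ^ 2 * (d : v.adicCompletion F)) *
            ((1 - x n' ^ 2 * (d : v.adicCompletion F))⁻¹ * (1 - x n' ^ 2 * (d : v.adicCompletion F))) by ring,
      inv_mul_cancel₀ h2, mul_one] at h
    linear_combination h / 2
  have hne : 1 + x n * x n' * (d : v.adicCompletion F) ≠ 0 := by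
    intro h0
    have hlt : normAbs (v.adicCompletion F) (x n * x n' * (d : v.adicCompletion F)) < 1 := by
      have hsq : normAbs (v.adicCompletion F) (x n * x n' * (d : v.adicCompletion F)) ^ 2 =
          normAbs (v.adicCompletion F) (x n ^ 2 * (d : v.adicCompletion F)) *
            normAbs (v.adicCompletion F) (x n' ^ 2 * (d : v.adicCompletion F)) := by
        rw [← map_pow, ← map_mul]; congr 1; ring
      have hPQ : normAbs (v.adicCompletion F) (x n ^ 2 * (d : v.adicCompletion F)) *
          normAbs (v.adicCompletion F) (x n' ^ 2 * (d : v.adicCompletion F)) < 1 :=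
        mul_lt_one_of_nonneg_of_lt_one_left zero_le (hxnd n) (hxnd n').le
      exact lt_of_pow_lt_pow_left₀ 2 zero_le (by rw [hsq, one_pow]; exact hPQ)
    have h1 := normAbs_one_sub_eq_one (K := v.adicCompletion F) (x := -(x n * x n' * (d : v.adicCompletion F)))
      (by rw [normAbs_neg]; exact hlt)
    rw [sub_neg_eq_add, h0, map_zero] at h1
    exact zero_ne_one h1
  have hxx : x n = x n' := by
    rcases mul_eq_zero.1 hprod with h | h
    · exact sub_eq_zero.1 h
    · exact absurd h hne
  -- `x₀ⁿ y = x₀ⁿ' y ⇒ n = n'` (norms)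
  have hpow : (residueFieldCard (v.adicCompletion F) : ℝ≥0)⁻¹ ^ n = (residueFieldCard (v.adicCompletion F) : ℝ≥0)⁻¹ ^ n' := by
    have h := congrArg (normAbs (v.adicCompletion F)) hxx
    rw [hx] at h
    simp only [map_mul, map_pow, hx₀] at h
    exact mul_right_cancel₀ ((map_ne_zero _).2 hy0) h
  have hqpos : 0 < (residueFieldCard (v.adicCompletion F) : ℝ≥0)⁻¹ := by
    rw [← hx₀]; exact pos_iff_ne_zero.2 ((map_ne_zero _).2 hx₀0)
  exact (pow_right_strictAnti₀ hqpos hq1).injective hpow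

end Torus

/-! ## §2 One line: coordinates of a multiple line, and the trace formula on `𝒮^L` -/

section OneLine

variable (F : Type) [Field F] [NumberField F] (E : Type) [Field E] [NumberField E] [Algebra F E]
  [Algebra.IsQuadraticExtension F E] (c : E ≃ₐ[F] E) (δ : E) (hcδ : c δ = -δ) (hδ : δ ≠ 0) (d : F)
  (hd : δ * δ = algebraMap F E d) (t : Matrix (Fin 1) (Fin 1) F) (ht : t.IsSymm) (htd : IsUnit t.det)
  (J₁ : Matrix (Fin 1) (Fin 1) E) (hJ₁ : J₁ = t.map (algebraMap F E)) (v : HeightOneSpectrum (𝓞 F))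
  (hE : IsField (UnitaryGroup.LocalRing E v))
  (s₁ : localPi E c 1 J₁ v →* LocalMp F 1 t v)
  (hs₁ : ∀ g, MpPsi.proj _ (s₁ g) = iota F E c 1 hcδ hδ hd t ht hJ₁ v g)
  (hsm₁ : Representation.IsSmooth ((MpPsi.toRep (localSchrodinger F 1 t v)).comp s₁))

include hd in
/-- **coordinates with respect to the multiple line `δ₂ = α δ`**: `re₂ = re`, `im₂ = α⁻¹ · im`.
[cite: MoeglinVignerasWaldspurger1987, Chap. 1 I.17] -/
theorem quadraticCoordinates_of_mul {δ₂ : E} (hcδ₂ : c δ₂ = -δ₂) (hδ₂ : δ₂ ≠ 0) {α : F} (hα0 : α ≠ 0)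
    (hα : δ₂ = algebraMap F E α * δ) (x : LocalRing E v) :
    QuadraticCoordinates.re (quadraticLocalEquiv E v c hcδ₂ hδ₂).toLinearEquiv.toAddEquiv x =
        QuadraticCoordinates.re (quadraticLocalEquiv E v c hcδ hδ).toLinearEquiv.toAddEquiv x ∧
      QuadraticCoordinates.im (quadraticLocalEquiv E v c hcδ₂ hδ₂).toLinearEquiv.toAddEquiv x =
        (α : v.adicCompletion F)⁻¹ *
          QuadraticCoordinates.im (quadraticLocalEquiv E v c hcδ hδ).toLinearEquiv.toAddEquiv x := by
  have hq := isQuadraticCoordinates_local E v c hcδ hδ hd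
  have hd₂ : δ₂ * δ₂ = algebraMap F E (α ^ 2 * d) := by rw [hα, map_mul, map_pow, ← hd]; ring
  have hq₂ := isQuadraticCoordinates_local E v c hcδ₂ hδ₂ hd₂
  have hα0' : (α : v.adicCompletion F) ≠ 0 := (map_ne_zero_iff _ (algebraMap F (v.adicCompletion F)).injective).2 hα0
  have hδ₂' : algebraMap E (LocalRing E v) δ₂ = toLocalRing E v (α : v.adicCompletion F) * algebraMap E (LocalRing E v) δ := by
    rw [hα, map_mul, toLocalRing_coe]
  have e := (hq.re_add_im x).symm
  have e' : x = toLocalRing E v (QuadraticCoordinates.re (quadraticLocalEquiv E v c hcδ hδ).toLinearEquiv.toAddEquiv x) +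
      toLocalRing E v ((α : v.adicCompletion F)⁻¹ *
        QuadraticCoordinates.im (quadraticLocalEquiv E v c hcδ hδ).toLinearEquiv.toAddEquiv x) *
        algebraMap E (LocalRing E v) δ₂ := by
    rw [hδ₂', ← mul_assoc, ← map_mul,
      show (α : v.adicCompletion F)⁻¹ * QuadraticCoordinates.im (quadraticLocalEquiv E v c hcδ hδ).toLinearEquiv.toAddEquiv x *
          (α : v.adicCompletion F) = QuadraticCoordinates.im (quadraticLocalEquiv E v c hcδ hδ).toLinearEquiv.toAddEquiv x by
        field_simp]
    exact e
  constructor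
  · conv_lhs => rw [e']
    exact hq₂.re_eq _ _
  · conv_lhs => rw [e']
    exact hq₂.im_eq _ _

set_option maxHeartbeats 1600000 in -- MEASURED: instantiating the explicit trace formula exceeds 800 k
include hcδ hδ hd ht htd hJ₁ hE hs₁ hsm₁ in
/-- **the explicit trace formula on `𝒮^L`** (★ `rankOne_torusTrace_eq_explicit` with `W = 𝒮^L`, whose finite
dimensionality comes from multiplicity one): near `z₀` (`z₀² ≠ 1`),
`tr(ω_{s₁}(z₀k) | 𝒮^L) = λ · |β|^{-1/2} · g(β⁻¹(1-a))`.
[cite: MoeglinVignerasWaldspurger1987, Chap. 2 II.8; Weil1964, n° 13 (16), p. 160] -/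
theorem rankOne_trace_fixedPoints_eq (z₀ : localPi E c 1 J₁ v) (hz₀ : z₀ * z₀ ≠ 1)
    [MeasurableSpace (v.adicCompletion F)] [BorelSpace (v.adicCompletion F)]
    (μ : Measure (v.adicCompletion F)) [μ.IsAddHaarMeasure] (m : ℤ) (hm : (adeleAddCharAt F v).HasConductorExp m) :
    ∃ K₀ : Subgroup (localPi E c 1 J₁ v), IsOpen (K₀ : Set (localPi E c 1 J₁ v)) ∧
      ∀ k ∈ K₀, ∀ (a b : v.adicCompletion F),
        a = QuadraticCoordinates.re (quadraticLocalEquiv E v c hcδ hδ).toLinearEquiv.toAddEquiv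
              (fun w : PlacesOver E v => (((z₀ * k : localPi E c 1 J₁ v) : LocalGLPi E 1 v) w).val 0 0) →
        b = QuadraticCoordinates.im (quadraticLocalEquiv E v c hcδ hδ).toLinearEquiv.toAddEquiv
              (fun w : PlacesOver E v => (((z₀ * k : localPi E c 1 J₁ v) : LocalGLPi E 1 v) w).val 0 0) →
        (d : v.adicCompletion F) * b * (localGram F 1 t v 0 0)⁻¹ ≠ 0 ∧
        ∀ L : Subgroup (localPi E c 1 J₁ v), IsOpen (L : Set (localPi E c 1 J₁ v)) → L ≤ K₀ → ∀ (lam : ℂ),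
          (∀ f : SchwartzBruhat (Fin 1 → v.adicCompletion F),
              ((MpPsi.toRep (localSchrodinger F 1 t v)).comp s₁) (z₀ * k) f =
                lam • bigCellOp (isLocallyConstant_of_isContinuousNontrivial (isContinuousNontrivial_adeleAddCharAt F v))
                  μ (isContinuousNontrivial_adeleAddCharAt F v) hm
                  (symplecticConj (gramProd (localGram F 1 t v)
                      (UnitaryGroup.isUnit_det_map (algebraMap F (v.adicCompletion F)) htd))
                    (polar_dotProductBilin_gramProd (localGram F 1 t v)
                      (UnitaryGroup.isUnit_det_map (algebraMap F (v.adicCompletion F)) htd))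
                    (iota F E c 1 hcδ hδ hd t ht hJ₁ v (z₀ * k))) f) →
          LinearMap.trace ℂ (Representation.fixedPoints ((MpPsi.toRep (localSchrodinger F 1 t v)).comp s₁) L)
              ((((MpPsi.toRep (localSchrodinger F 1 t v)).comp s₁) (z₀ * k)).restrict
                (apply_mem_fixedPoints_of_comm ((MpPsi.toRep (localSchrodinger F 1 t v)).comp s₁)
                  (localPi_one_mul_comm E c J₁ v) L (z₀ * k))) =
            lam * ((Real.sqrt (normAbs (v.adicCompletion F)
                ((d : v.adicCompletion F) * b * (localGram F 1 t v 0 0)⁻¹)) : ℝ) : ℂ)⁻¹ *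
              weilGauss (adeleAddCharAt F v) μ (((d : v.adicCompletion F) * b * (localGram F 1 t v 0 0)⁻¹)⁻¹ * (1 - a)) := by
  haveI : CompactSpace (localPi E c 1 J₁ v) := compactSpace_localPi_rankOne F E c hcδ hδ htd hJ₁ v hE
  have hcomm := localPi_one_mul_comm E c J₁ v
  obtain ⟨K₀, hK₀o, hK₀⟩ :=
    rankOne_torusTrace_eq_explicit F E c δ hcδ hδ d hd t ht htd J₁ hJ₁ v hE s₁ hs₁ hsm₁ z₀ hz₀ μ m hm
  refine ⟨K₀, hK₀o, fun k hk a b ha hb => ?_⟩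
  have hβT := hK₀ k hk a b ha hb
  refine ⟨hβT.1, fun L hLo hLK lam hlam => ?_⟩
  have hT := hβT.2
  haveI : FiniteDimensional ℂ (Representation.fixedPoints ((MpPsi.toRep (localSchrodinger F 1 t v)).comp s₁) L) :=
    finite_fixedPoints_of_finite_weightSpace _ hcomm L hLo fun χ hχ =>
      (finiteDimensional_weightSpace_rankOne F E c hcδ hδ hd ht htd hJ₁ v hE s₁ hs₁ hsm₁ χ
        (norm_apply_eq_one_of_isOpen_ker_rankOne F E c hcδ hδ htd hJ₁ v hE χ (Subgroup.isOpen_mono hχ hLo))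
        (continuous_apply_of_isOpen_ker_rankOne F E c htd hJ₁ v χ (Subgroup.isOpen_mono hχ hLo))).1
  exact hT L hLo hLK _ (fun f => Representation.mem_fixedPoints _ L f) _ lam hlam

end OneLine

end Literature.RepresentationTheory.MoeglinVignerasWaldspurger1987

end
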